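import Literature.Barriers.FinalStateConjecture.ExtremalHorizonPointwiseDecayFromEnergy
import HarnessLib

/-!
# Barrier catalogue `FinalStateConjecture`: Aretakis's pointwise horizon decay (JFA 2012, Thm. 5)
# — decomposition into the two energy theorems of the paper
# (`Literature/Barriers/FinalStateConjecture/`, D-0021, D-0014; family `gr`)

Fact-decomposition file (librarian, mode `fact-decompose`, 2026-08-16) for the named fact
`Literature.Barriers.FinalStateConjecture.Aretakis2012_pointwiseDecay`
(`ExtremalHorizonAxisymmetricDecay.lean`; S. Aretakis, J. Funct. Anal. 263 (2012) 2770–2831,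
Thm. 5: axisymmetric solutions of `□_{g_{M,M}}ψ = 0` on extremal Kerr with regular compactly
supported data decay pointwise along `𝓗⁺`).

The printed proof of Thm. 5 (§15) derives pointwise decay from the ENERGY theorems of §3 —
Thm. 1 (integrated local energy decay), Thm. 2 (uniform boundedness of the non-degenerate
energy and the near-horizon spacetime bound), Thm. 4 (pointwise boundedness) — proved by the
vector-field method in §§6–14. The catalogue PROVES §15 as a chain of reductions whose apex is
`Aretakis2012_pointwiseDecay_of_uniformBoundedness_of_integratedDecay`
(`ExtremalHorizonPointwiseDecayFromEnergy.lean`): the fact follows from two statements about every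
globally smooth, everywhere axisymmetric solution `Φ` on `U₀ ⊇ {r ≥ M, t* ≥ 0}` with localised
data, on the coordinate shells `{M ≤ r ≤ R₂} ⊂ {t* = τ}`
(`∫∫∫_M^{R₂}(·) = ∫₀^{2π}∫₀^π∫_M^{R₂}(·) dr dθ dφ`, `Kerr.shellIntegral`; `p = Kerr.shellPoint M τ r θ φ`,
`∂_ρΦ = dΦ(p)(0, n̂)`):

* (i) **uniform boundedness**: `∫∫∫_M^{R₂} sin θ (Φ² + (∂_ρΦ)²) ≤ C` for `τ ≥ τ₀` — the shape of
  Thm. 2 (uniform boundedness of `∫_{Σ_τ} J^N_μ[ψ] n^μ`) with Thm. 4 (pointwise boundedness,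
  for the `Φ²` term); vended here for EVERY `R₂ > M` as child `Aretakis2012_uniformBoundedness`;
* (ii) **integrated decay**: `τ ↦ ∫∫∫_M^{R₂} sin θ (Φ² + (r - M)²(∂_ρΦ)²)` integrable on `(τ₀, ∞)`
  for SOME `R₂ > M` — the shape of Thm. 2 (near-horizon spacetime bound, degenerate weight on
  the transversal derivative) and Thm. 1 (integrated local energy decay on `{r ≥ r_e}`), applied
  to `ψ` and `Tψ` (`∂_ρ = Y + T` along the leaves `{t* = const}`); child
  `Aretakis2012_integratedDecay` (the existential quantifier on `R₂` of the apex is kept).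

`Aretakis2012_pointwiseDecay_holds_of` PROVES the parent from (i) and (ii) (take `R₂` from (ii),
apply (i) there, `τ₀ = max`). Neither child restates the parent (energy statements on shells vs.
pointwise decay on the horizon spheres; the parent implies neither).

## References

* S. Aretakis, *Decay of axisymmetric solutions of the wave equation on extreme Kerr
  backgrounds*, J. Funct. Anal. 263 (2012) 2770–2831 (arXiv:1110.2006): §3 Thm. 1, Thm. 2,
  Thm. 4, Thm. 5; §15. [Aretakis2012]
* S. Aretakis, Adv. Theor. Math. Phys. 19 (2015) 507–530, §5.2 items 1–2. [Aretakis2015]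
-/

noncomputable section

open Set Filter MeasureTheory intervalIntegral
open scoped Topology ContDiff Manifold

namespace Literature.Barriers.FinalStateConjecture

open Literature.Geometry.Lorentzian

/-- **Aretakis 2012, Thm. 2 (uniform boundedness of the non-degenerate energy) with Thm. 4
(pointwise boundedness), shell form, every radius (child 1 of `Aretakis2012_pointwiseDecay`).**
Printed (§3): "there exists a constant `C > 0` which depends only on `M` and `Σ₀` such that for all
axisymmetric solutions `ψ` of the wave equation `∫_{Σ_τ} J^N_μ[ψ] n^μ_{Σ_τ} ≤ C ∫_{Σ₀} J^N_μ[ψ] n^μ_{Σ₀}`"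
(Thm. 2) and `|ψ| ≤ C √(E₁[ψ])` (Thm. 4). Lean form, for the class of the apex reduction
`Aretakis2012_pointwiseDecay_of_uniformBoundedness_of_integratedDecay` (extremal Kerr–Schild chart
`Kerr.region M r₀`, `0 < r₀ < M`; `Φ : E4 → ℝ` of class `C^∞`, axisymmetric, `□_{g_{M,M}}Φ = 0`
on an open `U₀ ⊇ {r ≥ M, t* ≥ 0}`, data on `{t* = 0}` supported in a coordinate ball): for every
`R₂ > M` there are `τ₀, C` with `∫₀^{2π}∫₀^π∫_M^{R₂} sin θ (Φ² + (∂_ρΦ)²)(Kerr.shellPoint M τ r θ φ) ≤ C`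
for all `τ ≥ τ₀` (`∂_ρΦ = dΦ(0, n̂(θ, φ))`, the coordinate radial derivative along the leaf).
[cite: Aretakis2012, §3 Thm. 2 and Thm. 4] -/
def Aretakis2012_uniformBoundedness : Prop :=
  ∀ [Kerr.Facts] [Kerr.SliceFacts] (M : ℝ), 0 < M → ∀ r₀ ∈ Set.Ioo 0 M,
    ∀ (U₀ : Set (Kerr.region M r₀)) (Φ : E4 → ℝ), IsOpen U₀ →
      {x : Kerr.region M r₀ | Kerr.rPlus M M ≤ Kerr.radius M (x : E4) ∧ 0 ≤ (x : E4) 0} ⊆ U₀ →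
      ContDiff ℝ ∞ Φ →
      (∀ x ∈ U₀, (Kerr.smoothMetric M M r₀).toPseudoRiemannianMetric.dalembertian
        (fun y : Kerr.region M r₀ ↦ Φ y) x = 0) →
      (∃ ρ : ℝ, ∀ x ∈ U₀, (x : E4) 0 = 0 → ρ < E4.spatialNorm (x : E4) →
        Φ x = 0 ∧ fderiv ℝ Φ x = 0) →
      (∀ (β : ℝ) (z : E4), Φ (E4.axialRotation β z) = Φ z) →
      ∀ R₂ : ℝ, M < R₂ → ∃ τ₀ C : ℝ,
        ∀ τ : ℝ, τ₀ ≤ τ → Kerr.shellIntegral M R₂ (fun r θ φ ↦ Real.sin θ *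
          (Φ (Kerr.shellPoint M τ r θ φ) ^ 2 +
            (fderiv ℝ Φ (Kerr.shellPoint M τ r θ φ) (E4.spaceEmbed (sphRadial θ φ))) ^ 2)) ≤ C

/-- **Aretakis 2012, Thm. 2 (near-horizon spacetime bound) with Thm. 1 (integrated local energy
decay), shell form (child 2 of `Aretakis2012_pointwiseDecay`).** Printed (§3): Thm. 1, for
`r_e > M`, "`∫_τ ∫_{Σ_τ ∩ {r ≥ r_e}} ((Tψ)² + (∂_{r*}ψ)² + χ|∇̸ψ|² + ψ²-terms) ≤ C E[ψ]`"
(degenerating only at the photon sphere, recovered after commuting with `T`), and Thm. 2,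
"`∫_{𝒜} [ψ² + (Tψ)² + (r - M)(Yψ)² + |∇̸ψ|²] ≤ C ∫_{Σ₀} J^N_μ[ψ]n^μ`" on the near-horizon region
`𝒜 = 𝓡 ∩ {M ≤ r ≤ 23M/21}`. Lean form, for the class of child 1: there are `R₂ > M` and `τ₀` such
that `τ ↦ ∫₀^{2π}∫₀^π∫_M^{R₂} sin θ (Φ² + (r - M)²(∂_ρΦ)²)(Kerr.shellPoint M τ r θ φ)` is
integrable on `(τ₀, ∞)` (`∂_ρ = Y + T` along `{t* = const}`; the weight `(r - M)²` is weaker than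
the printed `(r - M)`). [cite: Aretakis2012, §3 Thm. 1 and Thm. 2] -/
def Aretakis2012_integratedDecay : Prop :=
  ∀ [Kerr.Facts] [Kerr.SliceFacts] (M : ℝ), 0 < M → ∀ r₀ ∈ Set.Ioo 0 M,
    ∀ (U₀ : Set (Kerr.region M r₀)) (Φ : E4 → ℝ), IsOpen U₀ →
      {x : Kerr.region M r₀ | Kerr.rPlus M M ≤ Kerr.radius M (x : E4) ∧ 0 ≤ (x : E4) 0} ⊆ U₀ →
      ContDiff ℝ ∞ Φ →
      (∀ x ∈ U₀, (Kerr.smoothMetric M M r₀).toPseudoRiemannianMetric.dalembertian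
        (fun y : Kerr.region M r₀ ↦ Φ y) x = 0) →
      (∃ ρ : ℝ, ∀ x ∈ U₀, (x : E4) 0 = 0 → ρ < E4.spatialNorm (x : E4) →
        Φ x = 0 ∧ fderiv ℝ Φ x = 0) →
      (∀ (β : ℝ) (z : E4), Φ (E4.axialRotation β z) = Φ z) →
      ∃ R₂ τ₀ : ℝ, M < R₂ ∧
        IntegrableOn (fun τ ↦ Kerr.shellIntegral M R₂ (fun r θ φ ↦ Real.sin θ *
          (Φ (Kerr.shellPoint M τ r θ φ) ^ 2 + (r - M) ^ 2 *
            (fderiv ℝ Φ (Kerr.shellPoint M τ r θ φ) (E4.spaceEmbed (sphRadial θ φ))) ^ 2)))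
          (Ioi τ₀)

/-- **Assembly (PROVED): Thm. 5 (pointwise decay along `𝓗⁺`) from Thms. 1–2–4 in shell form.**
Take `R₂` from `Aretakis2012_integratedDecay`, the bound of `Aretakis2012_uniformBoundedness` on
the same shell, `τ₀ = max` of the two thresholds, and apply the apex reduction
`Aretakis2012_pointwiseDecay_of_uniformBoundedness_of_integratedDecay` (§15 of the source: cutoff
and rotation average, `T`-commutation, `L²(S_τ)` decay of the shells, Carter operator, spherical
Sobolev — all proved in the catalogue). [cite: Aretakis2012, Thm. 5 and §15] -/
theorem Aretakis2012_pointwiseDecay_holds_of (hbd : Aretakis2012_uniformBoundedness)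
    (hdec : Aretakis2012_integratedDecay) : Aretakis2012_pointwiseDecay := by
  refine Aretakis2012_pointwiseDecay_of_uniformBoundedness_of_integratedDecay ?_
  intro _ _ M hM r₀ hr₀ U₀ Φ hU₀ hK hΦ hsol hdata haxi
  obtain ⟨R₂, τ₁, hR₂, hint⟩ := hdec M hM r₀ hr₀ U₀ Φ hU₀ hK hΦ hsol hdata haxi
  obtain ⟨τ₂, C, hC⟩ := hbd M hM r₀ hr₀ U₀ Φ hU₀ hK hΦ hsol hdata haxi R₂ hR₂
  refine ⟨R₂, max τ₁ τ₂, C, hR₂, fun τ hτ ↦ hC τ ((le_max_right _ _).trans hτ), ?_⟩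
  exact hint.mono_set (Ioi_subset_Ioi (le_max_left _ _))

end Literature.Barriers.FinalStateConjecture

end
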